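import Summits.CriticalPhenomena.CardyFormulaZ2.Theorems.HalfPlaneMarkDensityLaw.Negative.MarkEvents
import Literature.Probability.Percolation.FiniteEnergy

/-!
# Independence of boundary isolation events in disjoint half-boxes (line `Sketch`, stub P)

Crux `Summit.CriticalPhenomena.CardyFormulaZ2.Theses.CardyBoundaryCoulombGas.HalfPlaneMarkDensityLaw`
(stmt-CriticalPhenomena-5661), line `Sketch`, stub `stub_isolationIndep`.

For critical bond percolation `μ = P_{1/2}` on `ℤ²` and the half-box
`Λ⁺_R(k) = [k−R, k+R] × [0, R]`, the left/right-isolated-arm events at the boundary vertex `(k,0)`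
are differences of two open-crossing events INSIDE `Λ⁺_R(k)`, hence determined by the states of
the edges with both endpoints in `Λ⁺_R(k)` (`PlanarDuality.determinedBy_openCrossing`). When
`k − k' > 2R` the half-boxes `Λ⁺_R(k)`, `Λ⁺_R(k')` are vertex-disjoint, so these edge sets are
disjoint and the product structure of `P_{1/2}` (`bondPercolation_real_inter_of_disjoint`) gives
`P(A ∩ B) = P(A) P(B)`; the stub records the two inequalities `≤` the line uses.

Sources: folklore (product measure, G. Grimmett, *Percolation*, 2nd ed. 1999, §2.2).
No named facts are used.
-/

noncomputable section

namespace Summit.CriticalPhenomena.CardyFormulaZ2.Cruxes.HalfPlaneMarkDensityLaw.SketchLine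

open Literature.Probability.Percolation Literature.Probability.LatticeModels
open MeasureTheory Filter Set
open Summit.CriticalPhenomena.CardyFormulaZ2.Theorems.HalfPlaneMarkDensityLaw.Negative

namespace Indep

/-- Set differences of events determined by `K` are determined by `K`. [folklore] -/
theorem determinedBy_diff {ι : Type*} {A B : Set (Set ι)} {K : Set ι} (hA : DeterminedBy A K)
    (hB : DeterminedBy B K) : DeterminedBy (A \ B) K := by
  rw [determinedBy_iff] at hA hB ⊢
  intro ω ω' h
  rw [Set.mem_sdiff, Set.mem_sdiff, hA ω ω' h, hB ω ω' h]

/-- An open-crossing event of a finite region `S` is determined by the pairs of sites of `S`.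
[folklore] -/
theorem determinedBy_openCrossing_finite {V : Type*} {S : Set V} (hS : S.Finite) (A B : Set V) :
    DeterminedBy (openCrossing S A B : Set (BondConfig V)) (↑hS.toFinset.sym2 : Set (Sym2 V)) := by
  have h := PlanarDuality.determinedBy_openCrossing hS.toFinset A B
  rwa [hS.coe_toFinset] at h

/-- Vertex-disjoint finite regions have disjoint sets of pairs of sites. [folklore] -/
theorem disjoint_sym2 {V : Type*} {S S' : Set V} (hS : S.Finite) (hS' : S'.Finite)
    (h : Disjoint S S') :
    Disjoint (↑hS.toFinset.sym2 : Set (Sym2 V)) (↑hS'.toFinset.sym2 : Set (Sym2 V)) := by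
  refine Set.disjoint_left.2 fun e he he' => ?_
  rw [Finset.mem_coe, Finset.mem_sym2_iff] at he he'
  induction e using Sym2.ind with
  | h a b =>
    have ha := he a (Sym2.mem_mk_left a b)
    have ha' := he' a (Sym2.mem_mk_left a b)
    rw [Set.Finite.mem_toFinset] at ha ha'
    exact Set.disjoint_left.1 h ha ha'

/-- **Product structure of `P_{1/2}`**: differences of open-crossing events inside two
vertex-disjoint finite regions are independent. [folklore] -/
theorem real_inter_diff_openCrossing {S S' : Set (Site 2)} (hS : S.Finite) (hS' : S'.Finite)
    (hSS' : Disjoint S S') (A B A' B' C D C' D' : Set (Site 2)) :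
    μ.real ((openCrossing S A B \ openCrossing S A' B') ∩
        (openCrossing S' C D \ openCrossing S' C' D')) =
      μ.real (openCrossing S A B \ openCrossing S A' B') *
        μ.real (openCrossing S' C D \ openCrossing S' C' D') :=
  bondPercolation_real_inter_of_disjoint (zdGraph 2) half (disjoint_sym2 hS hS' hSS')
    (determinedBy_diff (determinedBy_openCrossing_finite hS A B)
      (determinedBy_openCrossing_finite hS A' B'))
    (determinedBy_diff (determinedBy_openCrossing_finite hS' C D)
      (determinedBy_openCrossing_finite hS' C' D'))
    ((measurableSet_openCrossing_of_countable _ _ _).diff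
      (measurableSet_openCrossing_of_countable _ _ _))
    ((measurableSet_openCrossing_of_countable _ _ _).diff
      (measurableSet_openCrossing_of_countable _ _ _))

/-- The half-box `Λ⁺_R(k) = [k−R, k+R] × [0, R]` is finite. [folklore] -/
theorem halfBox_finite (k : ℤ) (R : ℕ) :
    ({v : Site 2 | 0 ≤ v 1 ∧ v 1 ≤ (R : ℤ) ∧ k - R ≤ v 0 ∧ v 0 ≤ k + R}).Finite := by
  refine (Set.finite_Icc (![k - R, 0] : Site 2) ![k + R, (R : ℤ)]).subset ?_
  rintro v ⟨h1, h2, h3, h4⟩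
  refine ⟨fun i => ?_, fun i => ?_⟩ <;> fin_cases i <;> simp [h1, h2, h3, h4]

/-- Half-boxes of radius `R` with centres more than `2R` apart are vertex-disjoint. [folklore] -/
theorem disjoint_halfBox {k k' : ℤ} {R : ℕ} (h : 2 * (R : ℤ) < k - k') :
    Disjoint {v : Site 2 | 0 ≤ v 1 ∧ v 1 ≤ (R : ℤ) ∧ k - R ≤ v 0 ∧ v 0 ≤ k + R}
      {v : Site 2 | 0 ≤ v 1 ∧ v 1 ≤ (R : ℤ) ∧ k' - R ≤ v 0 ∧ v 0 ≤ k' + R} := by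
  refine Set.disjoint_left.2 fun v hv hv' => ?_
  simp only [Set.mem_setOf_eq] at hv hv'
  omega

end Indep

/-- STUB P (independence of isolation events in disjoint half-boxes, product-measure structure of
`P_{1/2}`: the events are determined by the edges of their half-boxes, which are disjoint when the
centres are more than `2R` apart). Stated as the two sub-multiplicativity inequalities the line uses.
[folklore] -/
theorem stub_isolationIndep :
    ∀ (k k' : ℤ) (R : ℕ), 2 * (R : ℤ) < k - k' →
      μ.real ((openCrossing {v : Site 2 | 0 ≤ v 1 ∧ v 1 ≤ (R : ℤ) ∧ k - R ≤ v 0 ∧ v 0 ≤ k + R} {bpt k}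
                {v : Site 2 | v 0 = k - R ∨ v 0 = k + R ∨ v 1 = (R : ℤ)} \
              openCrossing {v : Site 2 | 0 ≤ v 1 ∧ v 1 ≤ (R : ℤ) ∧ k - R ≤ v 0 ∧ v 0 ≤ k + R}
                (rowIcc (k - R) (k - 1)) {bpt k}) ∩
            (openCrossing {v : Site 2 | 0 ≤ v 1 ∧ v 1 ≤ (R : ℤ) ∧ k' - R ≤ v 0 ∧ v 0 ≤ k' + R} {bpt k'}
                {v : Site 2 | v 0 = k' - R ∨ v 0 = k' + R ∨ v 1 = (R : ℤ)} \
              openCrossing {v : Site 2 | 0 ≤ v 1 ∧ v 1 ≤ (R : ℤ) ∧ k' - R ≤ v 0 ∧ v 0 ≤ k' + R}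
                (rowIcc (k' - R) (k' - 1)) {bpt k'})) ≤
        μ.real (openCrossing {v : Site 2 | 0 ≤ v 1 ∧ v 1 ≤ (R : ℤ) ∧ k - R ≤ v 0 ∧ v 0 ≤ k + R} {bpt k}
                {v : Site 2 | v 0 = k - R ∨ v 0 = k + R ∨ v 1 = (R : ℤ)} \
              openCrossing {v : Site 2 | 0 ≤ v 1 ∧ v 1 ≤ (R : ℤ) ∧ k - R ≤ v 0 ∧ v 0 ≤ k + R}
                (rowIcc (k - R) (k - 1)) {bpt k}) *
          μ.real (openCrossing {v : Site 2 | 0 ≤ v 1 ∧ v 1 ≤ (R : ℤ) ∧ k' - R ≤ v 0 ∧ v 0 ≤ k' + R} {bpt k'}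
                {v : Site 2 | v 0 = k' - R ∨ v 0 = k' + R ∨ v 1 = (R : ℤ)} \
              openCrossing {v : Site 2 | 0 ≤ v 1 ∧ v 1 ≤ (R : ℤ) ∧ k' - R ≤ v 0 ∧ v 0 ≤ k' + R}
                (rowIcc (k' - R) (k' - 1)) {bpt k'}) ∧
      μ.real ((openCrossing {v : Site 2 | 0 ≤ v 1 ∧ v 1 ≤ (R : ℤ) ∧ k - R ≤ v 0 ∧ v 0 ≤ k + R} {bpt k}
                {v : Site 2 | v 0 = k - R ∨ v 0 = k + R ∨ v 1 = (R : ℤ)} \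
              openCrossing {v : Site 2 | 0 ≤ v 1 ∧ v 1 ≤ (R : ℤ) ∧ k - R ≤ v 0 ∧ v 0 ≤ k + R}
                (rowIcc (k - R) (k - 1)) {bpt k}) ∩
            (openCrossing {v : Site 2 | 0 ≤ v 1 ∧ v 1 ≤ (R : ℤ) ∧ k' - R ≤ v 0 ∧ v 0 ≤ k' + R} {bpt k'}
                {v : Site 2 | v 0 = k' - R ∨ v 0 = k' + R ∨ v 1 = (R : ℤ)} \
              openCrossing {v : Site 2 | 0 ≤ v 1 ∧ v 1 ≤ (R : ℤ) ∧ k' - R ≤ v 0 ∧ v 0 ≤ k' + R}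
                (rowIcc (k' + 1) (k' + R)) {bpt k'})) ≤
        μ.real (openCrossing {v : Site 2 | 0 ≤ v 1 ∧ v 1 ≤ (R : ℤ) ∧ k - R ≤ v 0 ∧ v 0 ≤ k + R} {bpt k}
                {v : Site 2 | v 0 = k - R ∨ v 0 = k + R ∨ v 1 = (R : ℤ)} \
              openCrossing {v : Site 2 | 0 ≤ v 1 ∧ v 1 ≤ (R : ℤ) ∧ k - R ≤ v 0 ∧ v 0 ≤ k + R}
                (rowIcc (k - R) (k - 1)) {bpt k}) *
          μ.real (openCrossing {v : Site 2 | 0 ≤ v 1 ∧ v 1 ≤ (R : ℤ) ∧ k' - R ≤ v 0 ∧ v 0 ≤ k' + R} {bpt k'}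
                {v : Site 2 | v 0 = k' - R ∨ v 0 = k' + R ∨ v 1 = (R : ℤ)} \
              openCrossing {v : Site 2 | 0 ≤ v 1 ∧ v 1 ≤ (R : ℤ) ∧ k' - R ≤ v 0 ∧ v 0 ≤ k' + R}
                (rowIcc (k' + 1) (k' + R)) {bpt k'}) := by
  intro k k' R h
  exact ⟨(Indep.real_inter_diff_openCrossing (Indep.halfBox_finite k R) (Indep.halfBox_finite k' R)
      (Indep.disjoint_halfBox h) _ _ _ _ _ _ _ _).le,
    (Indep.real_inter_diff_openCrossing (Indep.halfBox_finite k R) (Indep.halfBox_finite k' R)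
      (Indep.disjoint_halfBox h) _ _ _ _ _ _ _ _).le⟩

end Summit.CriticalPhenomena.CardyFormulaZ2.Cruxes.HalfPlaneMarkDensityLaw.SketchLine
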